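import Summits.CriticalPhenomena.PercolationContinuityZ3.Theorems.Transplant.KNCells2Corridor
import HarnessLib

/-!
# F8 (generic, LAG-1 ANCHORS) — the corridor weighting is a subbox weighting IN A SUBGRAPH STRUCTURE (for `X □ ℤ²`: p3-g2's tube graph
# `tubeGraph X π ≤ X □ ℤ²`, in which the chain of target steps runs; design HOME/prim-bschramm-p2-g2/F8-DESIGN.md §9)

builds on p205010 (kernel theorem, internal audit signed; external expert review pending) — nothing in this file uses p205010.
Lane `prim-bschramm`, seat `prim-bschramm-p2` (Corridor-over-levels); helper file (`--supports stmt-CriticalPhenomena-4575`).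

* **`isSubbox_Wcor_graph`** — for `G' ≤ G` and `Dd ⊆ U ∩ (E_i ∪ E_{v,x} ∪ E_{x,y})` disjoint from `E_i`: if the `G`-edges inside `Dd` are
  `G'`-edges and every `G`-edge from a vertex of `U` outside `Dd` into `Dd` is a `G'`-edge, then `Wcor` is a subbox weighting of `G'` on `Dd`
  (`KNLevels.IsSubbox G' Wcor p Dd`) — the hypothesis `sub` of `LHyp` for the chain's steps in the tube graph (`lhyp_tube`).
[cite: KozmaNitzan2024, §4 p. 17 (subbox), p. 31] [cite: GrimmettPercolation1999, §7.2]
-/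

noncomputable section

open MeasureTheory ProbabilityTheory
open scoped ENNReal Classical

namespace Summit.CriticalPhenomena.PercolationContinuityZ3.Theorems

namespace Transplant

namespace KNCells

open Literature.Probability.Percolation Literature.Probability.LatticeModels SimpleGraph GadgetSystem ProbeHistory HSiteScheme Contour

variable {V : Type*} [DecidableEq V]

namespace KSchA

variable {A : Type*} {G : SimpleGraph V} [G.LocallyFinite] {S : KSchA V A} {FD : FaceData V A}
variable {h : ProbeHistory V} {e : Site 2 × MDir} {a a' : A} {du : MDir}

/-- **`Wcor` is a subbox weighting of a subgraph structure `G' ≤ G` on `Dd`** (`Dd ⊆ U ∩ (E_i ∪ E_{v,x} ∪ E_{x,y})` disjoint from `E_i`,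
`G`-edges inside `Dd` are `G'`-edges, `G`-edges from `U \\ Dd` into `Dd` are `G'`-edges). [cite: KozmaNitzan2024, §4 p. 17, p. 31] -/
theorem isSubbox_Wcor_graph (G' : SimpleGraph V) [G'.LocallyFinite] (hle : G' ≤ G) (hF : S.F G h = edgesIn G (S.Vx G h))
    {Dd : Finset V} (hD : Dd ⊆ S.Sx G h e a a' du) (hDU : Dd ⊆ S.Ucor G FD h e a a' du) (hdis : Disjoint Dd (S.Vx G h))
    (hin : ∀ u ∈ Dd, ∀ v ∈ Dd, G.Adj u v → G'.Adj u v)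
    (hout : ∀ v ∈ Dd, ∀ x ∈ S.Ucor G FD h e a a' du, x ∉ Dd → G.Adj x v → G'.Adj x v) :
    KNLevels.IsSubbox G' (S.Wcor G FD h e a a' du) S.p Dd := by
  have hfresh : ∀ u ∈ Dd, ∀ z, s(u, z) ∉ S.F G h := fun u hu z h' => by
    rw [hF, mem_edgesIn_iff] at h'
    exact Finset.disjoint_left.1 hdis hu (h'.2 u (Sym2.mem_mk_left _ _))
  refine ⟨fun u hu v hv huv => ?_, fun u hu v hv hne huv => ?_, fun v hv hvb x hx => ?_⟩
  · have huv' : G.Adj u v := hle huv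
    rw [Wcor_apply_of_mem (mk_mem_wireSet_iff.2 ⟨Finset.mem_coe.2 (hDU hu), Finset.mem_coe.2 (hDU hv), huv'.ne⟩)
      (mk_mem_wireSet_iff.2 ⟨Finset.mem_coe.2 (hD hu), Finset.mem_coe.2 (hD hv), huv'.ne⟩) (hfresh u hu v),
      KNLevels.lattW_apply, if_pos ((SimpleGraph.mem_edgeSet G).2 huv')]
  · have huv' : ¬G.Adj u v := fun h' => huv (hin u hu v hv h')
    rw [Wcor_apply_of_mem (mk_mem_wireSet_iff.2 ⟨Finset.mem_coe.2 (hDU hu), Finset.mem_coe.2 (hDU hv), hne⟩)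
      (mk_mem_wireSet_iff.2 ⟨Finset.mem_coe.2 (hD hu), Finset.mem_coe.2 (hD hv), hne⟩) (hfresh u hu v),
      KNLevels.lattW_apply, if_neg (fun h' => huv' ((SimpleGraph.mem_edgeSet G).1 h'))]
  · by_cases hxU : s(x, v) ∈ wireSet (↑(S.Ucor G FD h e a a' du) : Set V)
    · by_cases hxS : s(x, v) ∈ wireSet (↑(S.Sx G h e a a' du) : Set V)
      · have hxU' : x ∈ S.Ucor G FD h e a a' du := Finset.mem_coe.1 (hxU.1 x (Sym2.mem_mk_left _ _))
        have hnadj : ¬G.Adj x v := fun hadj =>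
          hvb ((mem_innerBoundary_iff).2 ⟨hv, x, hx, (hout v hv x hxU' hx hadj).symm⟩)
        rw [Sym2.eq_swap] at hxU hxS
        rw [Sym2.eq_swap, Wcor_apply_of_mem hxU hxS (hfresh v hv x), KNLevels.lattW_apply,
          if_neg (fun h' => hnadj ((SimpleGraph.mem_edgeSet G).1 h').symm)]
      · unfold Wcor Wfull
        rw [restrW_apply_of_mem _ hxU, restrW_apply_of_not_mem _ hxS]
    · unfold Wcor; exact restrW_apply_of_not_mem _ hxU

end KSchA

end KNCells

end Transplant

end Summit.CriticalPhenomena.PercolationContinuityZ3.Theorems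

end
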